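import Mathlib
import Summits.Ventures.PercRepro2.Defs
import Summits.Ventures.PercRepro2.Independence
import Summits.Ventures.PercRepro2.Harris
import Summits.Ventures.PercRepro2.FourFunctions
import Summits.Ventures.PercRepro2.BoxUnionDefs
import Summits.Ventures.PercRepro2.BoxUnion

/-!
# The box-union covariance inequality for finite bond percolation
(blind cell PercRepro2, mine-1 g37; the percolation corollary of `BoxUnion.boxUnion_nonneg`,
paper proof proofs/MINE1-BOXUNION.md)

The product Bernoulli weight on the configuration lattice `Config E = E → Bool` is log-modular
(`weight_inf_mul_weight_sup`), hence log-supermodular, so the lattice theorem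
`BoxUnion.boxUnion_nonneg` applies with `ν = weight p`.  The two boxes are percolation events:
`allClosed F = ↓(closed exactly on F)` (every edge of `F` closed) and
`allOpen F' = ↑(open exactly on F')` (every edge of `F'` open).  Hence, for admissible weights `p`, monotone observables `f g` and
ANY two edge sets `F F'`,

`∑_{ω : F all closed or F' all open} weight p ω · (f ω − E f)(g ω − E g) ≥ 0`

(`boxUnion_perc_nonneg`), and for increasing events `A B`

`P(A ∩ B ∩ U) + P(A) P(B) P(U) ≥ P(A) P(B ∩ U) + P(B) P(A ∩ U)`,  `U = allClosed F ∪ allOpen F'`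

(`prob_boxUnion_inequality`).  With `F = F' = ∅` (`U = univ`) the second form is Harris–FKG
`P(A) P(B) ≤ P(A ∩ B)`; the content is that the covariance of two increasing events stays
nonnegative when restricted to the union of a "down-box" and an "up-box".
-/

namespace Summit.Ventures.PercRepro2

open Finset

section BoxEvents

variable {E : Type*} [DecidableEq E]

/-- `allClosed F` is the principal down-set of the configuration closed exactly on `F`
(`fun e => decide (e ∉ F)`, open elsewhere). -/
lemma mem_allClosed_iff_le (F : Finset E) (ω : Config E) :
    ω ∈ allClosed F ↔ ω ≤ fun e => decide (e ∉ F) := by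
  constructor
  · intro h e
    by_cases he : e ∈ F
    · simp [he, h e he]
    · simp [he]
  · intro h e he
    have := h e
    simp only [he, not_true_eq_false, decide_false] at this
    exact Bool.eq_false_iff.mpr fun ht => Bool.false_ne_true (Bool.le_iff_imp.mp this ht)

/-- `allOpen F'` is the principal up-set of the configuration open exactly on `F'`
(`fun e => decide (e ∈ F')`). -/
lemma mem_allOpen_iff_le (F' : Finset E) (ω : Config E) :
    ω ∈ allOpen F' ↔ (fun e => decide (e ∈ F')) ≤ ω := by
  constructor
  · intro h e
    by_cases he : e ∈ F'
    · simp [he, h e he]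
    · simp [he]
  · intro h e he
    have := h e
    simp only [he, decide_true] at this
    exact Bool.le_iff_imp.mp this rfl

/-- The percolation event "`F` all closed or `F'` all open" is the box union
`↓(closed exactly on F) ∪ ↑(open exactly on F')`. -/
lemma allClosed_union_allOpen_eq_boxUnion (F F' : Finset E) :
    allClosed F ∪ allOpen F' =
      BoxUnion.boxUnion (fun e => decide (e ∉ F)) (fun e => decide (e ∈ F')) := by
  ext ω
  simp only [Set.mem_union, BoxUnion.mem_boxUnion, mem_allClosed_iff_le, mem_allOpen_iff_le]

end BoxEvents

section Percolation

open scoped Classical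

variable {E : Type*} [Fintype E] [DecidableEq E]

omit [DecidableEq E] in
/-- Log-supermodularity of the product weight (the equality `weight_inf_mul_weight_sup` read as
`≤`). -/
lemma weight_mul_weight_le_weight_inf_mul_weight_sup (p : E → ℝ) (ω ω' : Config E) :
    weight p ω * weight p ω' ≤ weight p (ω ⊓ ω') * weight p (ω ⊔ ω') :=
  (weight_inf_mul_weight_sup p ω ω').symm.le

/-- The lattice mean with respect to `weight p` is the expectation `expect p`. -/
lemma mean_weight_eq_expect (p : E → ℝ) (f : Config E → ℝ) :
    BoxUnion.mean (weight p) f = expect p f := by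
  unfold BoxUnion.mean expect
  rw [sum_weight, div_one]

/-- **Box-union covariance inequality for bond percolation.** For admissible weights, monotone
observables `f g` and ANY edge sets `F F'`, the covariance of `f` and `g` restricted to the event
"`F` all closed or `F'` all open" is nonnegative. -/
theorem boxUnion_perc_nonneg {p : E → ℝ} (hp : IsProbVec p) (F F' : Finset E)
    {f g : Config E → ℝ} (hf : Monotone f) (hg : Monotone g) :
    0 ≤ ∑ ω, if ω ∈ allClosed F ∪ allOpen F' then
      weight p ω * ((f ω - expect p f) * (g ω - expect p g)) else 0 := by
  classical
  have key := BoxUnion.boxUnion_nonneg (ν := weight p) (a := fun e => decide (e ∉ F))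
    (b := fun e => decide (e ∈ F'))
    (weight_nonneg hp) (weight_mul_weight_le_weight_inf_mul_weight_sup p)
    (by rw [sum_weight]; exact one_pos) hf hg
  simp only [mean_weight_eq_expect] at key
  refine le_of_le_of_eq key (Finset.sum_congr rfl fun ω _ => ?_)
  have hmem : ω ∈ BoxUnion.boxUnion (fun e => decide (e ∉ F)) (fun e => decide (e ∈ F')) ↔
      ω ∈ allClosed F ∪ allOpen F' := by
    rw [allClosed_union_allOpen_eq_boxUnion]
  by_cases h : ω ∈ allClosed F ∪ allOpen F'
  · rw [if_pos (hmem.mpr h), if_pos h]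
  · rw [if_neg (fun h' => h (hmem.mp h')), if_neg h]

/-- The indicator form: `E[ 1_U · (f − E f)(g − E g) ] ≥ 0` for `U = allClosed F ∪ allOpen F'`. -/
theorem expect_indicator_boxUnion_nonneg {p : E → ℝ} (hp : IsProbVec p) (F F' : Finset E)
    {f g : Config E → ℝ} (hf : Monotone f) (hg : Monotone g) :
    0 ≤ expect p ((allClosed F ∪ allOpen F').indicator
      (fun ω => (f ω - expect p f) * (g ω - expect p g))) := by
  classical
  refine le_of_le_of_eq (boxUnion_perc_nonneg hp F F' hf hg) ?_
  unfold expect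
  refine Finset.sum_congr rfl fun ω _ => ?_
  by_cases h : ω ∈ allClosed F ∪ allOpen F'
  · rw [if_pos h, Set.indicator_of_mem h]
  · rw [if_neg h, Set.indicator_of_notMem h, mul_zero]

/-- The event form, expanded: for increasing events `A B` and `U = allClosed F ∪ allOpen F'`,
`P(A) P(B ∩ U) + P(B) P(A ∩ U) ≤ P(A ∩ B ∩ U) + P(A) P(B) P(U)`.  (`F = F' = ∅` gives Harris–FKG.) -/
theorem prob_boxUnion_inequality {p : E → ℝ} (hp : IsProbVec p) (F F' : Finset E)
    {A B : Set (Config E)} (hA : IsUpperSet A) (hB : IsUpperSet B) :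
    prob p A * prob p (B ∩ (allClosed F ∪ allOpen F')) +
      prob p B * prob p (A ∩ (allClosed F ∪ allOpen F')) ≤
    prob p (A ∩ B ∩ (allClosed F ∪ allOpen F')) +
      prob p A * prob p B * prob p (allClosed F ∪ allOpen F') := by
  classical
  have key := boxUnion_perc_nonneg hp F F' (monotone_indicator_of_isUpperSet (R := ℝ) hA)
    (monotone_indicator_of_isUpperSet (R := ℝ) hB)
  rw [← prob_eq_expect_indicator, ← prob_eq_expect_indicator] at key
  set U : Set (Config E) := allClosed F ∪ allOpen F' with hU
  set PA := prob p A with hPA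
  set PB := prob p B with hPB
  have expand : ∀ ω, (if ω ∈ U then
      weight p ω * ((A.indicator 1 ω - PA) * (B.indicator 1 ω - PB)) else 0) =
      (A ∩ B ∩ U).indicator (weight p) ω + PA * PB * U.indicator (weight p) ω -
        (PA * (B ∩ U).indicator (weight p) ω + PB * (A ∩ U).indicator (weight p) ω) := by
    intro ω
    by_cases hUω : ω ∈ U
    · by_cases hAω : ω ∈ A
      · by_cases hBω : ω ∈ B
        · simp only [Set.indicator_apply, Set.mem_inter_iff, hUω, hAω, hBω, and_self, if_true,
            Pi.one_apply]
          ring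
        · simp only [Set.indicator_apply, Set.mem_inter_iff, hUω, hAω, hBω, and_self, and_true,
            and_false, if_true, if_false, Pi.one_apply]
          ring
      · by_cases hBω : ω ∈ B
        · simp only [Set.indicator_apply, Set.mem_inter_iff, hUω, hAω, hBω, and_self, and_true,
            if_true, if_false, Pi.one_apply]
          ring
        · simp only [Set.indicator_apply, Set.mem_inter_iff, hUω, hAω, hBω, and_self, and_true,
            if_true, if_false, Pi.one_apply]
          ring
    · simp only [Set.indicator_apply, Set.mem_inter_iff, hUω, and_false, if_false, mul_zero,
        add_zero, sub_zero]
  have hsum : (∑ ω, if ω ∈ U then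
      weight p ω * ((A.indicator 1 ω - PA) * (B.indicator 1 ω - PB)) else 0) =
      prob p (A ∩ B ∩ U) + PA * PB * prob p U - (PA * prob p (B ∩ U) + PB * prob p (A ∩ U)) := by
    rw [Finset.sum_congr rfl (fun ω _ => expand ω), Finset.sum_sub_distrib,
      Finset.sum_add_distrib, Finset.sum_add_distrib, ← Finset.mul_sum, ← Finset.mul_sum,
      ← Finset.mul_sum]
    rfl
  rw [hsum] at key
  linarith

end Percolation

end Summit.Ventures.PercRepro2
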